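import Literature.AnabelianGeometry.EtaleTheta.SettingModelTateDeckDisplay
import HarnessLib

/-!
# The STAGE-2 («Tate shear») model of [EtTh] §1 (R78), F7q part 2c: the unit-move of `log(Ü)` under `Π^tp_Y`
# (`β·log(Ü) = log(Ü) + log(−1)`, i.e. `κ_{−1} = (χ − 1)/2`) and Prop. 1.5 (iii) at `modelχq p 1 2`, UNCONDITIONALLY

S. Mochizuki, *The étale theta function and its Frobenioid-theoretic manifestations*, Publ. RIMS **45** (2009)
[EtTh], §1, Prop. 1.5 (iii), PRIMS PDF p. 23 ("`log(Ü) ↦ log(Ü) + a·log(q_X)/2 + log(O^×_K̈)`"; the unit classes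
`log(O^×_K̈)` contain `log(−1)`) [cite: MochizukiEtTh2009, Prop 1.5 (iii) p.23]. Layer L2 of the abc-iut cell, seat
abc-iut-L2-t6 (gen 6), R78 cluster hand #4, **F7q** part 2c. PROOF-ONLY (no definition, no instance, no `Prop` fact) over
parts 2a/2b (`SettingModelTateDeckLevels` / `SettingModelTateDeckDisplay`), part 1 (`SettingModelTateZClass`),
abc-iut-w5-d171's F6q (`kummerCoreχq`, `yCoordKitχq`), abc-iut-L2-t5's F3c/F3c-2 (`cycGen`, `cycEquiv`, `cycEquiv_smul`,
`cycEquiv_cycGen`, `kummerZH`, `kummerZH_mulRoots`), abc-iut-L2-t12's capstone and `unitLaw_GtpY_of_generators`.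
All consumed BY NAME, nothing restated.

THE COMPUTATION. Conjugating `log(Ü) = c^{ŷ/2}` by the `Π^tp_Y/Π^tp_Ÿ`-generator `β = (b, 1)` changes `ŷ(g)` into
`ŷ(g) − 1 + χ(τ)` (`hHat_gfpFst_bConjLeft`), so `β·log(Ü) = log(Ü) · c^{(χ(τ)−1)/2}`. The class `τ ↦ (χ(τ) − 1)/2 ∈ Ẑ(χ)`
IS the Kummer cocycle of `−1` for the root system `(ξ_{2N})_N` of `−1` built from the compatible primitive roots `ξ` of
record (`σ ξ_{2N} = ξ_{2N}^{χ(σ)}`, so `(σ ξ_{2N})/ξ_{2N} = ξ_N^{(χ−1)/2}`): `exists_rootSystem_negOne_sq` —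
`(κ_{−1}(σ))² = χ(σ)(η 1)·(η 1)⁻¹` — via `κ_{x·x} = κ_x²` and `e(σ•ξ) = χ(σ) e(ξ)`, `e ξ = η 1`. Hence
**`conj_beta_logUdd`**: `β·log(Ü) = log(Ü)·κ(−1)` ON THE NOSE (`−1 ∈ O^×_K̈`), **`unitLaw_GtpY_logUdd`** (= binder
`hLY` at the section datum of any Galois section `s`, via `Π^tp_Y ≤ ⟨β, Π^tp_Ÿ⟩`), and the UNCONDITIONAL capstone
**`prop15iii_etaleThetaDataOfClass_etaDdχq`**: [EtTh] Prop. 1.5 (iii) HOLDS at the stage-2 model `modelχq p 1 2` for the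
étale-theta datum carrying the `z`-class `η̈♯ = etaDdχq` over the section Kummer datum of any Galois section `s` —
census token «Prop15iii: WITNESSED at modelχq (Tate shear), REFUTED at the split modelχ (abc-iut-L2-t12)».

HONEST FRAMING: SEMI-SYNTHETIC model — consistency / non-vacuity evidence for the typed interface ONLY; nothing of [EtTh]
is asserted; typed ≠ proved; no side is taken on [IUTchIII] Cor. 3.12.
-/

noncomputable section

namespace Literature.AnabelianGeometry.EtaleTheta.SettingModel

open Literature.AnabelianGeometry.SemiGraphs _root_.Topology _root_.Function

variable (p : ℕ) [Fact p.Prime] (i j : ℤ)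

/-! ### §1. `κ_{−1} = (χ − 1)/2`: a root system of `−1` from the primitive roots of record -/

/-- `ξ₂ = −1` for the compatible primitive roots `ξ` of record. [cite: MochizukiEtTh2009, §1 p.13] -/
theorem coe_cycGen_two : (((cycGen p : ℕ+ → (PadicAlgCl p)ˣ) 2 : (PadicAlgCl p)ˣ) : PadicAlgCl p) = -1 :=
  (isPrimitiveRoot_coe_cycGen p 2).eq_neg_one_of_two_right

/-- `ξ_{2n}·ξ_{2n} = ξ_n`. [cite: MochizukiEtTh2009, §1 p.13] -/
theorem cycGen_two_mul_mul_self (n : ℕ+) :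
    (cycGen p : ℕ+ → (PadicAlgCl p)ˣ) (2 * n) * (cycGen p : ℕ+ → (PadicAlgCl p)ˣ) (2 * n) =
      (cycGen p : ℕ+ → (PadicAlgCl p)ˣ) n := by
  rw [← pow_two, mul_comm]
  exact (cycGen p).2.2 n 2

/-- **A root system of any unit `u = −1` built from `ξ`: `u^{1/N} := ξ_{2N}`, whose Kummer cocycle `κ_{−1}` satisfies
`κ_{−1}(σ)² = χ(σ)(η 1)·(η 1)⁻¹`** ("`κ_{−1} = (χ−1)/2`"). [cite: MochizukiEtTh2009, Prop 1.5 (iii) p.23] -/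
theorem exists_rootSystem_negOne_sq {u : (PadicAlgCl p)ˣ} (hu : (u : PadicAlgCl p) = -1)
    (hfix : u ∈ MulAction.fixedPoints (⊤ : Subgroup (GQp p)) (PadicAlgCl p)ˣ) :
    ∃ x : RootSystem u, ∀ σ : GQp p,
      kummerZH x hfix σ ^ 2 = chi p σ (ZHatLevel.eta 1) * (ZHatLevel.eta 1)⁻¹ := by
  have hu2 : (cycGen p : ℕ+ → (PadicAlgCl p)ˣ) 2 = u := Units.ext (by rw [coe_cycGen_two, hu])
  let x : RootSystem u :=
    ⟨fun n => (cycGen p : ℕ+ → (PadicAlgCl p)ˣ) (2 * n), by rw [mul_one]; exact hu2, fun n m => by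
      show (cycGen p : ℕ+ → (PadicAlgCl p)ˣ) (2 * (n * m)) ^ (m : ℕ) = (cycGen p : ℕ+ → (PadicAlgCl p)ˣ) (2 * n)
      rw [← mul_assoc]
      exact (cycGen p).2.2 (2 * n) m⟩
  have huu : u * u ∈ MulAction.fixedPoints (⊤ : Subgroup (GQp p)) (PadicAlgCl p)ˣ := fun g => by
    rw [smul_mul', hfix g]
  refine ⟨x, fun σ => ?_⟩
  have hcyc : (x.mul x).kummerCocycle (H := (⊤ : Subgroup (GQp p))) huu ⟨σ, Subgroup.mem_top σ⟩ =
      σ • cycGen p * (cycGen p)⁻¹ := by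
    refine Subtype.ext (funext fun n => ?_)
    rw [RootSystem.kummerCocycle_apply, RootSystem.mul_root, Subgroup.coe_mul, Subgroup.coe_inv, Pi.mul_apply,
      Pi.inv_apply, cyclotome.coe_smul, Pi.smul_apply]
    change σ • ((cycGen p : ℕ+ → (PadicAlgCl p)ˣ) (2 * n) * (cycGen p : ℕ+ → (PadicAlgCl p)ˣ) (2 * n)) /
        ((cycGen p : ℕ+ → (PadicAlgCl p)ˣ) (2 * n) * (cycGen p : ℕ+ → (PadicAlgCl p)ˣ) (2 * n)) = _
    rw [cycGen_two_mul_mul_self, div_eq_mul_inv]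
  rw [pow_two, ← kummerZH_mulRoots x x hfix hfix huu σ, kummerZH_def, hcyc, map_mul, map_inv, cycEquiv_smul,
    cycEquiv_cycGen]

/-! ### §2. `ŷ` under the generator `β = (b^t, 1)` and `β·log(Ü) = log(Ü)·κ(−1)` -/

/-- **`ŷ(β⁻¹ g β) = ŷ(g) · t⁻¹ · χ(τ)(t)`** for `β = (b^t, 1)` and `g = (γ, τ) ∈ Π^tp_Y`. [cite: MochizukiEtTh2009, Prop 1.5 (iii) p.23] -/
theorem yCoordχq_bConj (t : ZH) {g : PiTpχq p i j} (hg : gfpSnd g.left = 1) :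
    yCoordχq p i j ((SemidirectProduct.inl (bPowGfp t) : PiTpχq p i j)⁻¹ * g * SemidirectProduct.inl (bPowGfp t)) =
      yCoordχq p i j g * t⁻¹ * chi p g.right t := by
  rw [inl_inv_mul_mul_inl, yCoordχq_apply, yCoordχq_apply]
  show eHatB (gfpFst ((bPowGfp t)⁻¹ * g.left * actχq p i j g.right (bPowGfp t))) = _
  refine ext_of_modN fun N => ?_
  rw [map_mul (modN N), map_mul (modN N), map_inv (modN N), ← hHat_y_eq_modN_eHatB, ← hHat_y_eq_modN_eHatB,
    modN_eq_level N t, modN_eq_level N (chi p g.right t), hHat_gfpFst_bConjLeft p i j N g.right t hg, ofAdd_add,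
    ofAdd_sub, ofAdd_toAdd, ofAdd_toAdd, div_eq_mul_inv]

/-- `−1 ∈ O^×_K̈` (norm `1`). [cite: MochizukiEtTh2009, §1 p.17] -/
theorem negOne_mem_unitsOKdd (hj : Even j) : (-1 : (↥(ThetaSetting.modelχq p i j hj).Kdd)ˣ) ∈
    (ThetaSetting.modelχq p i j hj).unitsOKdd := by
  show ‖(((-1 : (↥(ThetaSetting.modelχq p i j hj).Kdd)ˣ) : (ThetaSetting.modelχq p i j hj).Kdd) : PadicAlgCl p)‖ = 1
  rw [Units.val_neg, Units.val_one]
  push_cast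
  rw [norm_neg, norm_one]

/-- The unit underlying `toInvYdd (−1)` is `−1 ∈ ℚ̄_p^×`. [cite: MochizukiEtTh2009, §1 p.17] -/
theorem coe_toInvYdd_negOne (hj : Even j) :
    ((((kummerCoreχq p i j hj).toInvYdd (-1 : (↥(ThetaSetting.modelχq p i j hj).Kdd)ˣ) :
      (kummerCoreχq p i j hj).invYdd) : (PadicAlgCl p)ˣ) : PadicAlgCl p) = -1 := by
  rw [ThetaSetting.KummerCore.coe_toInvYdd, Units.val_neg, Units.val_one]
  push_cast
  rfl

/-- **`β·log(Ü) = log(Ü)·κ(−1)` at the stage-2 model** (`β = (b, 1)`, any `i j`): conjugating `log(Ü) = c^{ŷ/2}` by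
`β` adds `(χ−1)/2 = κ_{−1}` — on the nose with the unit `−1`. [cite: MochizukiEtTh2009, Prop 1.5 (iii) p.23] -/
theorem conj_beta_logUdd (hj : Even j) (hC : (ThetaSetting.modelχq p i j hj).Compat) :
    haveI := hC.GtpYddTheta_normal
    ContH1.conj (MonoidHom.id (ThetaSetting.modelχq p i j hj).GtpTheta) (ThetaSetting.modelχq p i j hj).DeltaTheta
        ((ThetaSetting.modelχq p i j hj).toTheta (SemidirectProduct.inl (bPowGfp (ZHatLevel.eta 1))))
        (kummerCoreχq p i j hj).logUdd =
      (kummerCoreχq p i j hj).logUdd *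
        (kummerCoreχq p i j hj).toKummerData.kumYdd
          ((kummerCoreχq p i j hj).toKummerData.toKddHat (-1 : (↥(ThetaSetting.modelχq p i j hj).Kdd)ˣ)) := by
  haveI := hC.GtpYddTheta_normal
  letI := (ThetaSetting.modelχq p i j hj).unitsAction (kummerCoreχq p i j hj).augTheta
  -- the root system of `−1` of record and its square law
  have hfix : (((kummerCoreχq p i j hj).toInvYdd (-1 : (↥(ThetaSetting.modelχq p i j hj).Kdd)ˣ) :
      (kummerCoreχq p i j hj).invYdd) : (PadicAlgCl p)ˣ) ∈
        MulAction.fixedPoints (⊤ : Subgroup (GQp p)) (PadicAlgCl p)ˣ :=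
    mem_fixedPoints_top_of_forall fun σ => Units.ext (by
      rw [AlgEquiv.smul_units_def, Units.coe_map, MonoidHom.coe_coe, coe_toInvYdd_negOne, map_neg, map_one])
  obtain ⟨x, hx⟩ := exists_rootSystem_negOne_sq p (coe_toInvYdd_negOne p i j hj) hfix
  -- the Kummer class of `−1` as the class of the Kummer cocycle of `x`
  set K := (kummerCoreχq p i j hj).coeff.kummerContCocycle
    ((ThetaSetting.modelχq p i j hj).GtpYdd.map (ThetaSetting.modelχq p i j hj).toTheta) x
    ((kummerCoreχq p i j hj).toInvYdd (-1 : (↥(ThetaSetting.modelχq p i j hj).Kdd)ˣ)).2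
    (fun _ => (kummerCoreχq p i j hj).isOpen_stabilizer' _) with hK
  have hKq : (kummerCoreχq p i j hj).toKummerData.kumYdd
      ((kummerCoreχq p i j hj).toKummerData.toKddHat (-1 : (↥(ThetaSetting.modelχq p i j hj).Kdd)ˣ)) =
        ContH1.mk K.1 K.2 := by
    change (kummerCoreχq p i j hj).coeff.kummerContMap _ (kummerCoreχq p i j hj).isOpen_stabilizer'
        ((kummerCoreχq p i j hj).toInvYdd (-1 : (↥(ThetaSetting.modelχq p i j hj).Kdd)ˣ)) = _
    rw [(kummerCoreχq p i j hj).coeff.kummerContMap_apply_eq _ (kummerCoreχq p i j hj).isOpen_stabilizer' _ x]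
    rfl
  have hKapply : ∀ h : ↥((ThetaSetting.modelχq p i j hj).GtpYdd.map (ThetaSetting.modelχq p i j hj).toTheta),
      ((K.1 h : (ThetaSetting.modelχq p i j hj).DeltaTheta) : CurveTheta.GTheta (curveχq p i j)) =
        cThetaχq p i j (kummerZH x hfix (CurveTheta.augTheta (curveχq p i j) h.1)) := by
    intro h
    change ((deltaThetaCoordχq p i j (cycEquiv p (x.kummerCocycle _ h)) :
        (CurveTheta.thetaToEll (curveχq p i j)).ker) : CurveTheta.GTheta (curveχq p i j)) = _
    rw [coe_deltaThetaCoordχq, kummerZH_def]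
    congr 2
  rw [hKq]
  change ContH1.conj _ _ _ (ContH1.mk (yCoordKitχq p i j hj).logUddFun (yCoordKitχq p i j hj).logUddFun_mem) =
    ContH1.mk (yCoordKitχq p i j hj).logUddFun (yCoordKitχq p i j hj).logUddFun_mem * ContH1.mk K.1 K.2
  rw [ContH1.mk_mul_mk]
  change ContH1.mk (ContH1.conjCocycle _ _ _ ⟨(yCoordKitχq p i j hj).logUddFun,
      (yCoordKitχq p i j hj).logUddFun_mem⟩).1 (ContH1.conjCocycle _ _ _
        ⟨(yCoordKitχq p i j hj).logUddFun, (yCoordKitχq p i j hj).logUddFun_mem⟩).2 = _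
  refine ContH1.mk_congr _ (funext fun h => ?_) _ _
  obtain ⟨g, hg, hgh⟩ := h.2
  have hg0 : gfpSnd g.left = 1 :=
    gfpSnd_left_eq_one_of_mem_gtpY_modelχq p i j hj ((ThetaSetting.modelχq p i j hj).GtpYdd_le_GtpY hg)
  rw [ContH1.conjCocycle_apply, MonoidHom.id_apply, Pi.mul_apply]
  refine (conjNormal_toThetaq_eq_self p i j hj (SemidirectProduct.right_inl _) _).trans ?_
  apply Subtype.ext
  rw [Subgroup.coe_mul, hKapply]
  change ((deltaThetaCoordχq p i j (half ⟨yThetaχq p i j _, _⟩) : (CurveTheta.thetaToEll (curveχq p i j)).ker) :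
      CurveTheta.GTheta (curveχq p i j)) =
    ((deltaThetaCoordχq p i j (half ⟨yThetaχq p i j _, _⟩) : (CurveTheta.thetaToEll (curveχq p i j)).ker) :
      CurveTheta.GTheta (curveχq p i j)) * cThetaχq p i j (kummerZH x hfix (CurveTheta.augTheta (curveχq p i j) h.1))
  rw [coe_deltaThetaCoordχq, coe_deltaThetaCoordχq, ← map_mul]
  congr 1
  apply sqHom_injective
  have hc : Commute (half ⟨yThetaχq p i j h.1, (yCoordKitχq p i j hj).y_even h.1 h.2⟩)
      (kummerZH x hfix (CurveTheta.augTheta (curveχq p i j) h.1)) :=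
    Literature.AnabelianGeometry.AbsoluteAnabelian.ZHatCompletion.mul_comm _ _
  rw [sqHom_apply, sqHom_apply, half_sq, hc.mul_pow, half_sq, hx]
  change yThetaχq p i j ((MulAut.conjNormal ((ThetaSetting.modelχq p i j hj).toTheta
      (SemidirectProduct.inl (bPowGfp (ZHatLevel.eta 1))))⁻¹ h : _) : _) =
    yThetaχq p i j h.1 * (chi p (CurveTheta.augTheta (curveχq p i j) h.1) (ZHatLevel.eta 1) * (ZHatLevel.eta 1)⁻¹)
  rw [MulAut.conjNormal_apply, inv_inv, ← hgh]
  change yThetaχq p i j ((CurveTheta.toTheta (curveχq p i j) (SemidirectProduct.inl (bPowGfp (ZHatLevel.eta 1))))⁻¹ *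
      CurveTheta.toTheta (curveχq p i j) g * CurveTheta.toTheta (curveχq p i j)
        (SemidirectProduct.inl (bPowGfp (ZHatLevel.eta 1)))) =
    yThetaχq p i j (CurveTheta.toTheta (curveχq p i j) g) *
      (chi p (CurveTheta.augTheta (curveχq p i j) (CurveTheta.toTheta (curveχq p i j) g)) (ZHatLevel.eta 1) *
        (ZHatLevel.eta 1)⁻¹)
  rw [← map_inv, ← map_mul, ← map_mul, yThetaχq_toTheta, yThetaχq_toTheta, CurveTheta.augTheta_toTheta,
    yCoordχq_bConj p i j _ hg0, mul_assoc]
  congr 1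
  exact Literature.AnabelianGeometry.AbsoluteAnabelian.ZHatCompletion.mul_comm _ _

/-! ### §3. The unit-moves of `log(Ü)` under `Π^tp_Y` (binder `hLY`) and the unconditional capstone -/

/-- **`hLY` at the stage-2 model** (any `i j`, any Galois section `s`): every `y ∈ Π^tp_Y` moves `log(Ü)` by a unit
class (`κ(1)` on `Π^tp_Ÿ`, `κ(−1)` at `β`), by abc-iut-L2-t12's generator reduction. [cite: MochizukiEtTh2009, Prop 1.5 (iii) p.23] -/
theorem unitLaw_GtpY_logUdd (hj : Even j) (hC : (ThetaSetting.modelχq p i j hj).Compat)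
    (s : GQp p →* (ThetaSetting.modelχq p i j hj).PiTemp) (hs : Continuous s)
    (hsec : ∀ σ : GQp p, (ThetaSetting.modelχq p i j hj).aug (s σ) = σ)
    (hsY : (ThetaSetting.modelχq p i j hj).GK.map s ≤ (ThetaSetting.modelχq p i j hj).GtpY)
    (hsYdd : (ThetaSetting.modelχq p i j hj).GKdd.map s ≤ (ThetaSetting.modelχq p i j hj).GtpYdd) :
    haveI := hC.GtpYddTheta_normal
    ∀ y ∈ (ThetaSetting.modelχq p i j hj).GtpY, ∃ u ∈ (ThetaSetting.modelχq p i j hj).unitsOKdd,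
      ContH1.conj (MonoidHom.id (ThetaSetting.modelχq p i j hj).GtpTheta) (ThetaSetting.modelχq p i j hj).DeltaTheta
          ((ThetaSetting.modelχq p i j hj).toTheta y) (kummerCoreχq p i j hj).logUdd =
        (kummerCoreχq p i j hj).logUdd *
          ((kummerCoreχq p i j hj).toKummerDataOfSection s hs hsec hsY hsYdd).kumYdd
            (((kummerCoreχq p i j hj).toKummerDataOfSection s hs hsec hsY hsYdd).toKddHat u) := by
  haveI := hC.GtpYddTheta_normal
  refine ((kummerCoreχq p i j hj).toKummerDataOfSection s hs hsec hsY hsYdd).unitLaw_GtpY_of_generators hC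
    (kummerCoreχq p i j hj).logUdd ((kummerCoreχq p i j hj).conj_kumYdd_units_ofSection s hs hsec hsY hsYdd hC)
    {(SemidirectProduct.inl (bPowGfp (iotaZ (Multiplicative.ofAdd 1))) : PiTpχq p i j)}
    (GtpY_le_closure_beta_GtpYdd p i j hj) ?_
  intro y hy
  rw [Set.mem_singleton_iff] at hy
  subst hy
  refine ⟨-1, negOne_mem_unitsOKdd p i j hj, ?_⟩
  rw [kumYdd_toKddHat_ofSection_modelχq]
  exact conj_beta_logUdd p i j hj hC

/-- **[EtTh] Prop. 1.5 (iii) HOLDS at the stage-2 model `modelχq p 1 2`** for the étale-theta datum carrying the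
`z`-class `η̈♯ = etaDdχq` over the section Kummer datum of ANY Galois section `s` — all binders of abc-iut-L2-t12's
`prop15iii_etaleThetaDataOfClass_ofSection_of_generator` discharged at the Tate instance `(i, j) = (1, 2)`: the lift
`x′ = zClassYddχq`, the deck displays `hL₀`/`hx₀` at `σ₀ = (a, 1)` (units `1`), the unit-moves `hxY` (unit `1`) and `hLY`
(unit `−1`, `κ_{−1} = (χ−1)/2`). Census token «Prop15iii: WITNESSED at modelχq». [cite: MochizukiEtTh2009, Prop 1.5 (iii) p.23] -/
theorem prop15iii_etaleThetaDataOfClass_etaDdχq (hC : (ThetaSetting.modelχq p 1 2 even_two).Compat)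
    (s : GQp p →* (ThetaSetting.modelχq p 1 2 even_two).PiTemp) (hs : Continuous s)
    (hsec : ∀ σ : GQp p, (ThetaSetting.modelχq p 1 2 even_two).aug (s σ) = σ)
    (hsY : (ThetaSetting.modelχq p 1 2 even_two).GK.map s ≤ (ThetaSetting.modelχq p 1 2 even_two).GtpY)
    (hsYdd : (ThetaSetting.modelχq p 1 2 even_two).GKdd.map s ≤ (ThetaSetting.modelχq p 1 2 even_two).GtpYdd) :
    ThetaSetting.Prop15iii
      (((kummerCoreχq p 1 2 even_two).toKummerDataOfSection s hs hsec hsY hsYdd).etaleThetaDataOfClass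
        (etaDdχq p 1 2 even_two)) hC :=
  prop15iii_etaleThetaDataOfClass_etaDdχq_of_unitLaw_logUdd p hC s hs hsec hsY hsYdd
    (unitLaw_GtpY_logUdd p 1 2 even_two hC s hs hsec hsY hsYdd)

end Literature.AnabelianGeometry.EtaleTheta.SettingModel

end
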